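import Summits.MatrixMultiplication.MatrixMultiplication.Theorems.FarEdgeDescentSpectralEdge
import Literature.Computability.AlgebraicComplexity.RectangularExponentSubadditivity
import Literature.Computability.AlgebraicComplexity.RectangularExponentSymmetry
import Literature.Computability.AlgebraicComplexity.RectangularExponentBounds
import Literature.Computability.AlgebraicComplexity.RectangularExponentAlpha
import HarnessLib

/-!
# SaturationLadder on Strassen's spectrum, I: real shapes and the vertex collar

Support module (def-free, sorry-free) for route `SaturationLadder` (sub-problem `MatrixMultiplication`),
crux `SubexpSaturation` (stmt-MatrixMultiplication-25909); the cut of record (rev 7, `closes :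
SubexpSaturation → SubexpToPoly → PolyToFinite → TailDescentTwo → SquareFromTwo → ω = 2`) is unchanged.
Cell `decomp-mm`, lens 1 «grading / quantitative ladder», gen 12.  Part II: `SaturationLadderVertexGermCrux`.

Coordinates.  For a universal spectral point `φ ∈ X(ℂ)` (tree `IsUniversalSpectralPoint ℂ`) write
`u = φ⟨2,1,1⟩, v = φ⟨1,2,1⟩, w = φ⟨1,1,2⟩ ∈ [1,2]` (the sibling's multiplicative coordinates,
`FarEdgeDescentSpectralEdge.map_two_pow`) and `θ₀ = log₂ u, θ₁ = log₂ v, θ₂ = log₂ w ∈ [0,1]`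
(`theta_mem`) — Alman–Li's `θ(φ)` (Def. 4.1), spelled out as `Real.logb 2 (φ ⟨…⟩)` because the tree module
`AlmanLi2026SpectrumMatMul` is not built on the farm; `log₂ φ⟨2,2,2⟩ = θ₀ + θ₁ + θ₂` (`logb_cube_eq_sum`)
is the sibling cell's matrix exponent `τ_φ` (`OutsiderSandwichLaserFloor.two_le_matExp`: `τ_φ ≥ 2`), and
`Σθ − 2 ≥ 0` is the DARKNESS of `φ`; `ω = 2` iff every `φ` is bright (Part II, `mm_iff_spectral`).

The sibling route `FarEdgeDescent` reads its FAR shapes `(1,k,1)`, `k ∈ ℕ`, on the spectrum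
(`isGreatest_twoPow`: `2^{ω(a,b,c)} = max_φ φ⟨2^a,2^b,2^c⟩` for `(a,b,c) ∈ ℕ³`).  This ladder lives on
THIN shapes `(1,t,r)` with REAL `t ∈ [0,1)`, so it needs the dictionary for REAL shapes:

* `linear_le_omegaRect` — **for every universal spectral point and all real `x, y, z ≥ 0`:
  `x θ₀ + y θ₁ + z θ₂ ≤ ω(x,y,z)`** (natural shapes by duality `linear_le_omegaRect_nat`, rational ones by
  Lotti–Romani homogeneity, real ones by upper continuity `omegaRect_add_le_add_pos`);
  `omegaRect_natShape_le_iff`, `omegaRect_ratShape_le_iff` — for RATIONAL shapes the bound `ω ≤ B` IS the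
  halfspace `· ≤ B` on `X(ℂ)` (the easy half of Strassen's `ω(a,b,c) = max_Δ`, for all real directions).
* THE VERTEX COLLAR.  A tight thin shape `ω(1,t,r) ≤ 1 + r` is the halfspace `θ₀ + t θ₁ + r θ₂ ≤ 1 + r`
  (`halfspace_of_tight`; converse at rational `(t,r)`: `tight_of_halfspace_rat`), i.e. the darkness bound
  `Σθ − 2 ≤ (r − 1)(1 − θ₂) + (1 − t) θ₁` (`collar_of_tight`), whose right-hand side vanishes on the bright
  triangle `{Σθ = 2} ∩ [0,1]³` only at the VERTEX `θ = (1,0,1)` (for `t < 1 < r`): every exact certificate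
  of this ladder exposes ONE VERTEX of the bright triangle, the far certificates `(1,k,1)` an EDGE
  (`{θ₁ = 1}`), and `ω = 2` the whole face.

No new definitions, no named facts, no sorry.  Placement [cite: Strassen1988, Thm. 3.8, Prop. 4.5]
[cite: AlmanLi2026, Definition 4.1, Propositions 4.1–4.2] [cite: LottiRomani1983, §1 (p. 173)].
-/

set_option linter.dupNamespace false

noncomputable section

namespace Summit.MatrixMultiplication.MatrixMultiplication.Theorems.SaturationLadderVertexGerm

open Real (logb)
open Literature.Computability.AlgebraicComplexity
open Summit.MatrixMultiplication.MatrixMultiplication.Theorems.FarEdgeDescentSpectralEdge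
  (isGreatest_twoPow one_le_map map_le_card map_two_pow)


/-! ## §0 Coordinates `u, v, w ∈ [1,2]`, `θ = log₂ ∈ [0,1]` -/

/-- `1 ≤ φ⟨2,1,1⟩`, `1 ≤ φ⟨1,2,1⟩`, `1 ≤ φ⟨1,1,2⟩`. [cite: ChristandlLeGallLysikovZuiddam2025, Def. 3.1] -/
theorem one_le_coords {F : SpectralMap ℂ} (hF : IsUniversalSpectralPoint ℂ F) :
    1 ≤ F (matMulTensor ℂ 2 1 1) ∧ 1 ≤ F (matMulTensor ℂ 1 2 1) ∧ 1 ≤ F (matMulTensor ℂ 1 1 2) :=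
  ⟨one_le_map hF (by norm_num) le_rfl le_rfl, one_le_map hF le_rfl (by norm_num) le_rfl,
    one_le_map hF le_rfl le_rfl (by norm_num)⟩

/-- `φ⟨2,1,1⟩, φ⟨1,2,1⟩, φ⟨1,1,2⟩ ≤ 2`. [cite: Blaser2013, §5] -/
theorem coords_le_two {F : SpectralMap ℂ} (hF : IsUniversalSpectralPoint ℂ F) :
    F (matMulTensor ℂ 2 1 1) ≤ 2 ∧ F (matMulTensor ℂ 1 2 1) ≤ 2 ∧ F (matMulTensor ℂ 1 1 2) ≤ 2 := by
  have h0 := map_le_card hF 2 1 1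
  have h1 := map_le_card hF 1 2 1
  have h2 := map_le_card hF 1 1 2
  norm_num at h0 h1 h2
  exact ⟨h0, h1, h2⟩

/-- `log₂ x ∈ [0,1]` for `x ∈ [1,2]`. [folklore] -/
theorem logb_two_mem {x : ℝ} (h1 : 1 ≤ x) (h2 : x ≤ 2) : 0 ≤ logb 2 x ∧ logb 2 x ≤ 1 := by
  refine ⟨Real.logb_nonneg one_lt_two h1, ?_⟩
  calc logb 2 x ≤ logb 2 2 := Real.logb_le_logb_of_le one_lt_two (by linarith) h2
    _ = 1 := Real.logb_self_eq_one one_lt_two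

/-- **`θ(φ) ∈ [0,1]³`** (Alman–Li Prop. 4.2, first part). [cite: AlmanLi2026, Proposition 4.2] -/
theorem theta_mem {F : SpectralMap ℂ} (hF : IsUniversalSpectralPoint ℂ F) :
    (0 ≤ logb 2 (F (matMulTensor ℂ 2 1 1)) ∧ logb 2 (F (matMulTensor ℂ 2 1 1)) ≤ 1) ∧
      (0 ≤ logb 2 (F (matMulTensor ℂ 1 2 1)) ∧ logb 2 (F (matMulTensor ℂ 1 2 1)) ≤ 1) ∧
        (0 ≤ logb 2 (F (matMulTensor ℂ 1 1 2)) ∧ logb 2 (F (matMulTensor ℂ 1 1 2)) ≤ 1) :=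
  ⟨logb_two_mem (one_le_coords hF).1 (coords_le_two hF).1,
    logb_two_mem (one_le_coords hF).2.1 (coords_le_two hF).2.1,
    logb_two_mem (one_le_coords hF).2.2 (coords_le_two hF).2.2⟩

/-- `x^n = 2^{n·log₂ x}` for `x > 0`. [folklore] -/
theorem pow_eq_two_rpow {x : ℝ} (hx : 0 < x) (n : ℕ) : x ^ n = (2 : ℝ) ^ ((n : ℝ) * logb 2 x) := by
  rw [mul_comm (n : ℝ), Real.rpow_mul (by norm_num : (0 : ℝ) ≤ 2),
    Real.rpow_logb two_pos (by norm_num) hx, Real.rpow_natCast]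

/-- **`φ⟨2^a, 2^b, 2^c⟩ = 2^{a θ₀ + b θ₁ + c θ₂}`** (Alman–Li Prop. 4.1 on power-of-two formats, from the
sibling's `map_two_pow`). [cite: AlmanLi2026, Proposition 4.1] -/
theorem map_twoPow_eq_rpow {F : SpectralMap ℂ} (hF : IsUniversalSpectralPoint ℂ F) (a b c : ℕ) :
    F (matMulTensor ℂ (2 ^ a) (2 ^ b) (2 ^ c)) =
      (2 : ℝ) ^ ((a : ℝ) * logb 2 (F (matMulTensor ℂ 2 1 1)) + (b : ℝ) * logb 2 (F (matMulTensor ℂ 1 2 1)) +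
        (c : ℝ) * logb 2 (F (matMulTensor ℂ 1 1 2))) := by
  obtain ⟨hu, hv, hw⟩ := one_le_coords hF
  rw [map_two_pow hF a b c, pow_eq_two_rpow (by linarith) a, pow_eq_two_rpow (by linarith) b,
    pow_eq_two_rpow (by linarith) c, ← Real.rpow_add two_pos, ← Real.rpow_add two_pos]

/-- **Darkness is the matrix exponent minus two**: `log₂ φ⟨2,2,2⟩ = θ₀ + θ₁ + θ₂` (the sibling cell's
`τ_φ`, `OutsiderSandwichLaserFloor.two_le_matExp`: `τ_φ ≥ 2`). [cite: AlmanLi2026, Proposition 4.2] -/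
theorem logb_cube_eq_sum {F : SpectralMap ℂ} (hF : IsUniversalSpectralPoint ℂ F) :
    logb 2 (F (matMulTensor ℂ 2 2 2)) =
      logb 2 (F (matMulTensor ℂ 2 1 1)) + logb 2 (F (matMulTensor ℂ 1 2 1)) +
        logb 2 (F (matMulTensor ℂ 1 1 2)) := by
  obtain ⟨hu, hv, hw⟩ := one_le_coords hF
  have h := map_two_pow hF 1 1 1
  rw [SpectralMap.map_matMulTensor_congr F (pow_one 2) (pow_one 2) (pow_one 2)] at h
  simp only [pow_one] at h
  rw [h, Real.logb_mul (by positivity) (by positivity), Real.logb_mul (by positivity) (by positivity)]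

/-! ## §1 The dictionary in logarithmic coordinates: natural, rational, real shapes -/

/-- **Easy duality, natural shapes**: `a θ₀ + b θ₁ + c θ₂ ≤ ω(a,b,c)` for every universal spectral point.
[cite: Strassen1988, Thm. 3.8] -/
theorem linear_le_omegaRect_nat {F : SpectralMap ℂ} (hF : IsUniversalSpectralPoint ℂ F) (a b c : ℕ) :
    (a : ℝ) * logb 2 (F (matMulTensor ℂ 2 1 1)) + (b : ℝ) * logb 2 (F (matMulTensor ℂ 1 2 1)) +
        (c : ℝ) * logb 2 (F (matMulTensor ℂ 1 1 2)) ≤ omegaRect ℂ a b c := by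
  have h : F (matMulTensor ℂ (2 ^ a) (2 ^ b) (2 ^ c)) ≤ (2 : ℝ) ^ omegaRect ℂ a b c :=
    (isGreatest_twoPow (K := ℂ) a b c).2 ⟨F, hF, rfl⟩
  rw [map_twoPow_eq_rpow hF] at h
  exact (Real.rpow_le_rpow_left_iff one_lt_two).1 h

/-- **Attained duality, natural shapes**: some universal spectral point has `a θ₀ + b θ₁ + c θ₂ = ω(a,b,c)`.
[cite: Strassen1988, Thm. 3.8] -/
theorem exists_linear_eq_omegaRect_nat (a b c : ℕ) :
    ∃ F : SpectralMap ℂ, IsUniversalSpectralPoint ℂ F ∧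
      (a : ℝ) * logb 2 (F (matMulTensor ℂ 2 1 1)) + (b : ℝ) * logb 2 (F (matMulTensor ℂ 1 2 1)) +
          (c : ℝ) * logb 2 (F (matMulTensor ℂ 1 1 2)) = omegaRect ℂ a b c := by
  obtain ⟨F, hF, hval⟩ := (isGreatest_twoPow (K := ℂ) a b c).1
  have hval' : F (matMulTensor ℂ (2 ^ a) (2 ^ b) (2 ^ c)) = (2 : ℝ) ^ omegaRect ℂ a b c := hval
  refine ⟨F, hF, ?_⟩
  rw [map_twoPow_eq_rpow hF] at hval'
  exact le_antisymm ((Real.rpow_le_rpow_left_iff one_lt_two).1 hval'.le)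
    ((Real.rpow_le_rpow_left_iff one_lt_two).1 hval'.ge)

/-- **Natural shapes: `ω(a,b,c) ≤ B` iff the halfspace `a θ₀ + b θ₁ + c θ₂ ≤ B` contains the spectrum.**
[cite: Strassen1988, Thm. 3.8] -/
theorem omegaRect_natShape_le_iff (a b c : ℕ) (B : ℝ) :
    omegaRect ℂ a b c ≤ B ↔ ∀ F : SpectralMap ℂ, IsUniversalSpectralPoint ℂ F →
      (a : ℝ) * logb 2 (F (matMulTensor ℂ 2 1 1)) + (b : ℝ) * logb 2 (F (matMulTensor ℂ 1 2 1)) +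
          (c : ℝ) * logb 2 (F (matMulTensor ℂ 1 1 2)) ≤ B := by
  constructor
  · intro h F hF
    exact (linear_le_omegaRect_nat hF a b c).trans h
  · intro h
    obtain ⟨F, hF, hF'⟩ := exists_linear_eq_omegaRect_nat a b c
    rw [← hF']
    exact h F hF

/-- Homogeneity `ω(x/d, y/d, z/d) = ω(x,y,z)/d` (`d > 0`, `x,y,z ≥ 0`). [cite: LottiRomani1983, §1 (p. 173)] -/
theorem omegaRect_shape_div {x y z : ℝ} (hx : 0 ≤ x) (hy : 0 ≤ y) (hz : 0 ≤ z) {d : ℝ} (hd : 0 < d) :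
    omegaRect ℂ (x / d) (y / d) (z / d) = omegaRect ℂ x y z / d := by
  have h := LottiRomani1983_homogeneous ℂ (ν := d⁻¹) (inv_nonneg.2 hd.le) hx hy hz
  rw [inv_mul_eq_div, inv_mul_eq_div, inv_mul_eq_div, inv_mul_eq_div] at h
  exact h

/-- **Rational shapes: `ω(a/d, b/d, c/d) ≤ B` iff the halfspace `(a/d)θ₀ + (b/d)θ₁ + (c/d)θ₂ ≤ B`
contains the spectrum** (`a, b, c, d ∈ ℕ`, `d ≥ 1`). [cite: Strassen1988, Thm. 3.8]
[cite: LottiRomani1983, §1 (p. 173)] -/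
theorem omegaRect_ratShape_le_iff (a b c : ℕ) {d : ℕ} (hd : 1 ≤ d) (B : ℝ) :
    omegaRect ℂ ((a : ℝ) / d) ((b : ℝ) / d) ((c : ℝ) / d) ≤ B ↔
      ∀ F : SpectralMap ℂ, IsUniversalSpectralPoint ℂ F →
        (a : ℝ) / d * logb 2 (F (matMulTensor ℂ 2 1 1)) + (b : ℝ) / d * logb 2 (F (matMulTensor ℂ 1 2 1)) +
          (c : ℝ) / d * logb 2 (F (matMulTensor ℂ 1 1 2)) ≤ B := by
  have hd0 : (0 : ℝ) < d := by exact_mod_cast hd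
  rw [omegaRect_shape_div (Nat.cast_nonneg a) (Nat.cast_nonneg b) (Nat.cast_nonneg c) hd0,
    div_le_iff₀ hd0, omegaRect_natShape_le_iff]
  refine forall_congr' fun F => forall_congr' fun hF => ?_
  rw [← div_le_iff₀ hd0]
  have e : ((a : ℝ) * logb 2 (F (matMulTensor ℂ 2 1 1)) + (b : ℝ) * logb 2 (F (matMulTensor ℂ 1 2 1)) +
      (c : ℝ) * logb 2 (F (matMulTensor ℂ 1 1 2))) / d =
        (a : ℝ) / d * logb 2 (F (matMulTensor ℂ 2 1 1)) + (b : ℝ) / d * logb 2 (F (matMulTensor ℂ 1 2 1)) +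
          (c : ℝ) / d * logb 2 (F (matMulTensor ℂ 1 1 2)) := by ring
  rw [e]

/-- **Easy duality for REAL shapes**: for every universal spectral point and all real `x, y, z ≥ 0`,
`x θ₀ + y θ₁ + z θ₂ ≤ ω(x, y, z)` — the rectangular exponent dominates the support function of the
spectrum in every nonnegative real direction (rational shapes from above, upper continuity of `ω`).
[cite: Strassen1988, Thm. 3.8] [cite: LottiRomani1983, §1 (p. 173)] -/
theorem linear_le_omegaRect {F : SpectralMap ℂ} (hF : IsUniversalSpectralPoint ℂ F) {x y z : ℝ}
    (hx : 0 ≤ x) (hy : 0 ≤ y) (hz : 0 ≤ z) :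
    x * logb 2 (F (matMulTensor ℂ 2 1 1)) + y * logb 2 (F (matMulTensor ℂ 1 2 1)) +
        z * logb 2 (F (matMulTensor ℂ 1 1 2)) ≤ omegaRect ℂ x y z := by
  obtain ⟨⟨hθ0, -⟩, ⟨hθ1, -⟩, ⟨hθ2, -⟩⟩ := theta_mem hF
  refine le_of_forall_pos_le_add fun ε hε => ?_
  obtain ⟨d, hd⟩ := exists_nat_gt (3 / ε)
  have h3ε : 0 < 3 / ε := by positivity
  have hd0 : (0 : ℝ) < d := h3ε.trans hd
  have hdne : (d : ℝ) ≠ 0 := hd0.ne'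
  have hd1 : 1 ≤ d := Nat.succ_le_of_lt (Nat.cast_pos.1 hd0)
  -- ceilings `⌈u d⌉/d ∈ [u, u + 1/d]`
  have up : ∀ {u : ℝ}, 0 ≤ u → u ≤ (⌈u * d⌉₊ : ℝ) / d ∧ (⌈u * d⌉₊ : ℝ) / d - u ≤ 1 / d := by
    intro u hu
    have hc1 : u * d ≤ ⌈u * d⌉₊ := Nat.le_ceil _
    have hc2 : (⌈u * d⌉₊ : ℝ) < u * d + 1 := Nat.ceil_lt_add_one (by positivity)
    constructor
    · rw [le_div_iff₀ hd0]; exact hc1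
    · rw [sub_le_iff_le_add, div_le_iff₀ hd0]
      have e : (1 / d + u) * d = u * d + 1 := by field_simp; ring
      rw [e]; exact hc2.le
  obtain ⟨hxa, hax⟩ := up hx
  obtain ⟨hyb, hby⟩ := up hy
  obtain ⟨hzc, hcz⟩ := up hz
  set a := ⌈x * d⌉₊
  set b := ⌈y * d⌉₊
  set c := ⌈z * d⌉₊
  -- the rational shape from above dominates the linear form and is within `3/d` of `ω(x,y,z)`
  have h1 : x * logb 2 (F (matMulTensor ℂ 2 1 1)) + y * logb 2 (F (matMulTensor ℂ 1 2 1)) +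
      z * logb 2 (F (matMulTensor ℂ 1 1 2)) ≤
        (a : ℝ) / d * logb 2 (F (matMulTensor ℂ 2 1 1)) + (b : ℝ) / d * logb 2 (F (matMulTensor ℂ 1 2 1)) +
          (c : ℝ) / d * logb 2 (F (matMulTensor ℂ 1 1 2)) :=
    add_le_add_three (mul_le_mul_of_nonneg_right hxa hθ0) (mul_le_mul_of_nonneg_right hyb hθ1)
      (mul_le_mul_of_nonneg_right hzc hθ2)
  have h2 : (a : ℝ) / d * logb 2 (F (matMulTensor ℂ 2 1 1)) + (b : ℝ) / d * logb 2 (F (matMulTensor ℂ 1 2 1)) +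
      (c : ℝ) / d * logb 2 (F (matMulTensor ℂ 1 1 2)) ≤ omegaRect ℂ ((a : ℝ) / d) ((b : ℝ) / d) ((c : ℝ) / d) :=
    (omegaRect_ratShape_le_iff a b c hd1 _).1 le_rfl F hF
  have h3 := omegaRect_add_le_add_pos ℂ x y z ((a : ℝ) / d - x) ((b : ℝ) / d - y) ((c : ℝ) / d - z)
  rw [add_sub_cancel, add_sub_cancel, add_sub_cancel] at h3
  have hm : max ((a : ℝ) / d - x) 0 + max ((b : ℝ) / d - y) 0 + max ((c : ℝ) / d - z) 0 ≤ 3 / d := by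
    have e : (3 : ℝ) / d = 1 / d + 1 / d + 1 / d := by ring
    rw [e]
    exact add_le_add_three (max_le hax (by positivity)) (max_le hby (by positivity))
      (max_le hcz (by positivity))
  have h4 : 3 / (d : ℝ) < ε := by
    rw [div_lt_iff₀ hd0]; rw [div_lt_iff₀ hε] at hd; linarith
  linarith

/-! ## §2 Tight thin shapes as halfspaces; the vertex collar -/

/-- **Tight ⟹ halfspace** (real `t, r ≥ 0`): `ω(1,t,r) ≤ 1 + r` puts the spectrum in
`θ₀ + t θ₁ + r θ₂ ≤ 1 + r`. [cite: Strassen1988, Thm. 3.8] -/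
theorem halfspace_of_tight {t r : ℝ} (ht : 0 ≤ t) (hr : 0 ≤ r) (h : omegaRect ℂ 1 t r ≤ 1 + r)
    {F : SpectralMap ℂ} (hF : IsUniversalSpectralPoint ℂ F) :
    logb 2 (F (matMulTensor ℂ 2 1 1)) + t * logb 2 (F (matMulTensor ℂ 1 2 1)) +
        r * logb 2 (F (matMulTensor ℂ 1 1 2)) ≤ 1 + r := by
  have h' := linear_le_omegaRect hF zero_le_one ht hr
  rw [one_mul] at h'
  exact h'.trans h

/-- **The vertex collar**: a tight thin shape `(1,t,r)` bounds the DARKNESS `Σθ − 2` of every universal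
spectral point by `(r − 1)(1 − θ₂) + (1 − t) θ₁` — the bound vanishes on the bright triangle only at the
vertex `θ = (1,0,1)` (`θ₂ = 1`, `θ₁ = 0`) when `t < 1 < r`. [cite: Strassen1988, Thm. 3.8] -/
theorem collar_of_tight {t r : ℝ} (ht : 0 ≤ t) (hr : 0 ≤ r) (h : omegaRect ℂ 1 t r ≤ 1 + r)
    {F : SpectralMap ℂ} (hF : IsUniversalSpectralPoint ℂ F) :
    logb 2 (F (matMulTensor ℂ 2 1 1)) + logb 2 (F (matMulTensor ℂ 1 2 1)) +
        logb 2 (F (matMulTensor ℂ 1 1 2)) - 2 ≤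
      (r - 1) * (1 - logb 2 (F (matMulTensor ℂ 1 1 2))) + (1 - t) * logb 2 (F (matMulTensor ℂ 1 2 1)) := by
  have h' := halfspace_of_tight ht hr h hF
  linarith

/-- **Halfspace ⟹ tight, rational shapes** (`t = p/d`, `r = s/d`): if `θ₀ + t θ₁ + r θ₂ ≤ 1 + r` on the
spectrum then `ω(1,t,r) ≤ 1 + r`. [cite: Strassen1988, Thm. 3.8] [cite: LottiRomani1983, §1 (p. 173)] -/
theorem tight_of_halfspace_rat (p s : ℕ) {d : ℕ} (hd : 1 ≤ d)
    (h : ∀ F : SpectralMap ℂ, IsUniversalSpectralPoint ℂ F →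
      logb 2 (F (matMulTensor ℂ 2 1 1)) + (p : ℝ) / d * logb 2 (F (matMulTensor ℂ 1 2 1)) +
          (s : ℝ) / d * logb 2 (F (matMulTensor ℂ 1 1 2)) ≤ 1 + (s : ℝ) / d) :
    omegaRect ℂ 1 ((p : ℝ) / d) ((s : ℝ) / d) ≤ 1 + (s : ℝ) / d := by
  have hd0 : (d : ℝ) ≠ 0 := by exact_mod_cast (Nat.one_le_iff_ne_zero.1 hd)
  have hdd : (d : ℝ) / d = 1 := div_self hd0
  have key := (omegaRect_ratShape_le_iff d p s hd (1 + (s : ℝ) / d)).2 fun F hF => by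
    rw [hdd, one_mul]; exact h F hF
  rwa [hdd] at key

end Summit.MatrixMultiplication.MatrixMultiplication.Theorems.SaturationLadderVertexGerm

end
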